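import Literature.RingTheory.LocalCohomology.CechDirectedUnion
import Mathlib.LinearAlgebra.Isomorphisms
import HarnessLib

/-!
# Saturations in `N[1/ab]` and the local cohomology groups `H¹, H²_{(a,b)}(N)` without complexes

Topic `Literature/RingTheory/LocalCohomology`, sequel of `CechVanishing.lean` and
`CechDirectedUnion.lean`. This is the module-theoretic core of Česnavičius's proof of Kawasaki's
theorem on the Cohen–Macaulayness of the blow-ups `Bl_{∏(r_1,…,r_i)}(M)` (Česnavičius 2021,
Thm. 3.13 = Kawasaki 2000, Thm. 4.1): for a module `N` over a commutative ring `A` and two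
`N`-regular elements `a, b`, the local cohomology groups `H¹_{(a,b)}(N)` and `H²_{(a,b)}(N)` and the
"rows `j' = 1, 2`" of loc. cit. (Claims 3.13.1–3.13.2 and (bam-2)–(bam-4)) are recast in terms of
concrete submodules of the localisation `Ω = N[1/ab]`, so that no double complex or spectral
sequence is needed:

* `sat ι x = {ω ∈ Ω | xⁿ ω ∈ N for some n}` (`ι : N → Ω` the localisation map); `sat ι b` is the
  image of `N[1/b]` (`range_kappa`), so that `H¹_{(a,b)}(N) ≅ (sat a ⊓ sat b)/N` (`E1`, symmetric
  in `a, b`) and `H²_{(a,b)}(N) ≅ Ω/(sat a + sat b)` (`E2`, symmetric);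
* for the chart "denominator `b`": `V_b = N[1/b]/N`, the map `φ_b : V_b → Ω/sat a` induced by
  `κ_b : N[1/b] → Ω`, with `ker φ_b = Γ_a(V_b) ≅ E1` (`kerPhiEquiv`) and
  `(Ω/sat a)/range φ_b ≅ E2` (`cokerPhiEquiv`), and `a` bijective on `Ω/sat a`;
* **the depth derivation** (`cechVanishBelow_ker_phi`, `cechVanishBelow_coker_phi`,
  `cechVanishBelow_E1_E2`): if `Hʲ_{(y)}(N) = 0` and `Hʲ_{(y)}(range φ_b) = 0` for `j < m + 1`
  (`a, b ∈ √(y)`), then `Hʲ_{(y)}(ker φ_b) = 0` and `Hʲ_{(y)}((Ω/sat a)/range φ_b) = 0` for `j < m`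
  — the two-row long exact sequence of loc. cit., Claim 3.13.1, by two-out-of-three only;
* **the pieces** `ψ_k : N → V_b`, `n ↦ n/bᵏ`, exhausting `V_b`, with `ker (φ_b ∘ ψ_k)` = the
  `a`-saturation of `bᵏN` (`mem_ker_phi_comp_psi_iff`), and the directed-union statement
  `cechVanishBelow_range_phi_of_pieces` feeding `Hʲ(range φ_b) = 0` from the pieces
  `N / ker(φ_b ∘ ψ_k)` (loc. cit., (bam-3)–(bam-bam)).

Everything is proved; no named facts. The localisations are abstract (`IsLocalizedModule`), so the
symmetric statements are obtained by swapping `a` and `b`.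

## References

* [Cesnavicius2021] K. Česnavičius, *Macaulayfication of Noetherian schemes*, Duke Math. J. 170
  (2021), proof of Thm. 3.13 (Claims 3.13.1, 3.13.2, (bam-1)–(bam-4)).
* [Kawasaki2000] T. Kawasaki, *On Macaulayfication of Noetherian schemes*, Trans. AMS 352 (2000),
  Thm. 4.1, Lemma 4.3.
* [StacksProject] The Stacks Project, Tag 0A6R.
-/

noncomputable section

universe u

namespace Literature.RingTheory.LocalCohomology

open Pointwise

variable {A : Type u} [CommRing A] {N Ω : Type u} [AddCommGroup N] [Module A N] [AddCommGroup Ω]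
  [Module A Ω] (ι : N →ₗ[A] Ω)

/-! ## Saturations -/

/-- **The `x`-saturation of `N` in `Ω`**: `{ω | xⁿ ω ∈ ι(N) for some n}`.
[cite: Cesnavicius2021, proof of Thm. 3.13] -/
def sat (x : A) : Submodule A Ω where
  carrier := {ω | ∃ n : ℕ, x ^ n • ω ∈ LinearMap.range ι}
  add_mem' := by
    rintro ω ω' ⟨n, hn⟩ ⟨n', hn'⟩
    refine ⟨n + n', ?_⟩
    rw [smul_add]
    refine Submodule.add_mem _ ?_ ?_
    · rw [pow_add, mul_comm, mul_smul]
      exact Submodule.smul_mem _ _ hn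
    · rw [pow_add, mul_smul]
      exact Submodule.smul_mem _ _ hn'
  zero_mem' := ⟨0, by rw [smul_zero]; exact Submodule.zero_mem _⟩
  smul_mem' := by
    rintro c ω ⟨n, hn⟩
    refine ⟨n, ?_⟩
    rw [smul_comm]
    exact Submodule.smul_mem _ c hn

/-- Membership in the saturation. [folklore] -/
theorem mem_sat_iff {x : A} {ω : Ω} : ω ∈ sat ι x ↔ ∃ n : ℕ, x ^ n • ω ∈ LinearMap.range ι :=
  Iff.rfl

/-- `ι(N) ⊆ sat x`. [folklore] -/
theorem range_le_sat (x : A) : LinearMap.range ι ≤ sat ι x := fun ω hω =>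
  ⟨0, by rwa [pow_zero, one_smul]⟩

/-- `sat x` is stable under division by `x`: `x ω ∈ sat x → ω ∈ sat x`. [folklore] -/
theorem mem_sat_of_smul_mem {x : A} {ω : Ω} (h : x • ω ∈ sat ι x) : ω ∈ sat ι x := by
  obtain ⟨n, hn⟩ := h
  exact ⟨n + 1, by rwa [pow_succ, mul_smul]⟩

/-! ## The localisation `Ω = N[1/ab]` -/

/-- Cancellation of an element acting as a unit. [folklore] -/
theorem smul_cancel_of_isUnit {x : A} (hx : IsUnit (algebraMap A (Module.End A Ω) x)) {ω ω' : Ω}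
    (h : x • ω = x • ω') : ω = ω' :=
  ((Module.End.isUnit_iff _).mp hx).1 h

/-- `a` and `b` act invertibly on `Ω = N[1/ab]`. [folklore] -/
theorem isUnit_smul_pair (a b : A) [IsLocalizedModule (Submonoid.powers (a * b)) ι] :
    IsUnit (algebraMap A (Module.End A Ω) a) ∧ IsUnit (algebraMap A (Module.End A Ω) b) := by
  have h := IsLocalizedModule.map_units ι (⟨(a * b) ^ 1, 1, rfl⟩ : Submonoid.powers (a * b))
  change IsUnit (algebraMap A (Module.End A Ω) ((a * b) ^ 1)) at h
  rw [pow_one, map_mul] at h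
  exact ((Commute.all a b).map (algebraMap A (Module.End A Ω))).isUnit_mul_iff.mp h

/-- Powers of `a` act invertibly on `Ω`. [folklore] -/
theorem isUnit_smul_pow_left (a b : A) [IsLocalizedModule (Submonoid.powers (a * b)) ι] (n : ℕ) :
    IsUnit (algebraMap A (Module.End A Ω) (a ^ n)) := by
  rw [map_pow]; exact (isUnit_smul_pair ι a b).1.pow n

/-- Powers of `b` act invertibly on `Ω`. [folklore] -/
theorem isUnit_smul_pow_right (a b : A) [IsLocalizedModule (Submonoid.powers (a * b)) ι] (n : ℕ) :
    IsUnit (algebraMap A (Module.End A Ω) (b ^ n)) := by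
  rw [map_pow]; exact (isUnit_smul_pair ι a b).2.pow n

/-- Every element of `Ω` has `(ab)ⁿ ω ∈ ι(N)` for some `n`. [folklore] -/
theorem exists_mul_pow_smul_mem_range (a b : A) [IsLocalizedModule (Submonoid.powers (a * b)) ι]
    (ω : Ω) : ∃ n : ℕ, (a * b) ^ n • ω ∈ LinearMap.range ι := by
  obtain ⟨⟨m, s⟩, h⟩ := IsLocalizedModule.surj (Submonoid.powers (a * b)) ι ω
  obtain ⟨n, hn⟩ := (Submonoid.mem_powers_iff _ _).mp s.2
  refine ⟨n, m, ?_⟩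
  rw [← h, Submonoid.smul_def, ← hn]

variable {ι} in
/-- **`ι` is injective when `a` and `b` are `N`-regular.** [folklore] -/
theorem injective_of_isSMulRegular {a b : A} [IsLocalizedModule (Submonoid.powers (a * b)) ι]
    (ha : IsSMulRegular N a) (hb : IsSMulRegular N b) : Function.Injective ι := by
  rw [← LinearMap.ker_eq_bot, LinearMap.ker_eq_bot']
  intro n hn
  obtain ⟨⟨s, k, rfl⟩, hs⟩ := (IsLocalizedModule.eq_zero_iff (Submonoid.powers (a * b)) ι).mp hn
  rw [Submonoid.smul_def] at hs
  exact ((ha.mul hb).pow k) (by simpa using hs)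

/-! ## `a` acts bijectively on `Ω / sat a` -/

/-- `a ↦ a • -` is bijective on `Ω / sat a`. [cite: Cesnavicius2021, proof of Thm. 3.13] -/
theorem smul_bijective_quotient_sat (a b : A) [IsLocalizedModule (Submonoid.powers (a * b)) ι] :
    Function.Bijective fun w : Ω ⧸ sat ι a => a • w := by
  constructor
  · intro w w' h
    induction w using Submodule.Quotient.induction_on with | _ ω =>
    induction w' using Submodule.Quotient.induction_on with | _ ω' =>
    dsimp only at h
    rw [← Submodule.Quotient.mk_smul, ← Submodule.Quotient.mk_smul, Submodule.Quotient.eq,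
      ← smul_sub] at h
    rw [Submodule.Quotient.eq]
    exact mem_sat_of_smul_mem ι h
  · intro w
    induction w using Submodule.Quotient.induction_on with | _ ω =>
    obtain ⟨u, hu⟩ := (isUnit_smul_pair ι a b).1
    refine ⟨Submodule.Quotient.mk ((↑u⁻¹ : Module.End A Ω) ω), ?_⟩
    dsimp only
    rw [← Submodule.Quotient.mk_smul]
    congr 1
    have : a • ((↑u⁻¹ : Module.End A Ω) ω) = (u * u⁻¹ : Module.End A Ω) ω := by
      rw [Module.End.mul_apply, hu]; rfl
    rw [this, Units.mul_inv, Module.End.one_apply]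

/-- Symmetrically, `b ↦ b • -` is bijective on `Ω / sat b`.
[cite: Cesnavicius2021, proof of Thm. 3.13] -/
theorem smul_bijective_quotient_sat_right (a b : A)
    [IsLocalizedModule (Submonoid.powers (a * b)) ι] :
    Function.Bijective fun w : Ω ⧸ sat ι b => b • w := by
  haveI : IsLocalizedModule (Submonoid.powers (b * a)) ι := by rw [mul_comm]; infer_instance
  exact smul_bijective_quotient_sat ι b a

/-! ## The pieces `n ↦ n / bᵏ` exhausting `N[1/b]/N` -/

section LocB

variable {Nb : Type u} [AddCommGroup Nb] [Module A Nb] (ιb : N →ₗ[A] Nb) (b : A)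

/-- Every element of `N[1/b]` is `n / bᵏ`: `bᵏ v = ι_b n`. [folklore] -/
theorem exists_pow_smul_eq_iotab [IsLocalizedModule (Submonoid.powers b) ιb] (v : Nb) :
    ∃ (k : ℕ) (n : N), b ^ k • v = ιb n := by
  obtain ⟨⟨n, s⟩, h⟩ := IsLocalizedModule.surj (Submonoid.powers b) ιb v
  obtain ⟨k, hk⟩ := (Submonoid.mem_powers_iff _ _).mp s.2
  exact ⟨k, n, by rw [← h, Submonoid.smul_def, ← hk]⟩

/-- The unit `bᵏ` on `N[1/b]`. [folklore] -/
theorem isUnit_smul_pow_iotab [IsLocalizedModule (Submonoid.powers b) ιb] (k : ℕ) :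
    IsUnit (algebraMap A (Module.End A Nb) (b ^ k)) :=
  IsLocalizedModule.map_units ιb (⟨b ^ k, k, rfl⟩ : Submonoid.powers b)

variable {b} in
/-- `ι_b` is injective for `b` regular on `N`. [folklore] -/
theorem iotab_injective [IsLocalizedModule (Submonoid.powers b) ιb] (hb : IsSMulRegular N b) :
    Function.Injective ιb := by
  rw [← LinearMap.ker_eq_bot, LinearMap.ker_eq_bot']
  intro n hn
  obtain ⟨⟨s, k, rfl⟩, hs⟩ := (IsLocalizedModule.eq_zero_iff (Submonoid.powers b) ιb).mp hn
  rw [Submonoid.smul_def] at hs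
  exact (hb.pow k) (by simpa using hs)

variable {s : ℕ} {y : Fin s → A}

variable {b} in
/-- `N[1/b]` has no local cohomology supported in `V(y) ⊆ V(b)`. [cite: Eisenbud2005, Cor. A1.2] -/
theorem cechVanishBelow_loc [IsLocalizedModule (Submonoid.powers b) ιb]
    (hb : b ∈ (Ideal.span (Set.range y)).radical) (k : ℕ) :
    CechVanishBelow y Nb k :=
  CechVanishBelow.of_isUnit_smul hb (IsLocalizedModule.map_units ιb (⟨b, 1, pow_one b⟩ :
    Submonoid.powers b)) k

variable {b} in
/-- `Hʲ(N[1/b]/N) = 0` for `j < m` if `Hʲ(N) = 0` for `j < m + 1`.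
[cite: Cesnavicius2021, proof of Thm. 3.13] -/
theorem cechVanishBelow_quotient_range [IsLocalizedModule (Submonoid.powers b) ιb]
    (hb : b ∈ (Ideal.span (Set.range y)).radical)
    (hbN : IsSMulRegular N b) {m : ℕ} (hN : CechVanishBelow y N (m + 1)) :
    CechVanishBelow y (Nb ⧸ LinearMap.range ιb) m :=
  CechVanishBelow.right_of_forall (iotab_injective ιb hbN) (Submodule.mkQ_surjective _)
    (LinearMap.exact_map_mkQ_range ιb) (cechVanishBelow_loc ιb hb) hN


/-- The unit `bᵏ` on `N[1/b]`. [folklore] -/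
def powUnit [IsLocalizedModule (Submonoid.powers b) ιb] (k : ℕ) : (Module.End A Nb)ˣ :=
  (isUnit_smul_pow_iotab ιb b k).unit

/-- `bᵏ • (bᵏ)⁻¹ v = v`. [folklore] -/
theorem pow_smul_powUnit_inv [IsLocalizedModule (Submonoid.powers b) ιb] (k : ℕ) (v : Nb) :
    b ^ k • ((↑(powUnit ιb b k)⁻¹ : Module.End A Nb) v) = v := by
  have : b ^ k • ((↑(powUnit ιb b k)⁻¹ : Module.End A Nb) v) =
      ((powUnit ιb b k : Module.End A Nb) * ↑(powUnit ιb b k)⁻¹) v := rfl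
  rw [this, Units.mul_inv, Module.End.one_apply]

/-- `(bᵏ)⁻¹ (bᵏ • v) = v`. [folklore] -/
theorem powUnit_inv_pow_smul [IsLocalizedModule (Submonoid.powers b) ιb] (k : ℕ) (v : Nb) :
    (↑(powUnit ιb b k)⁻¹ : Module.End A Nb) (b ^ k • v) = v := by
  have : (↑(powUnit ιb b k)⁻¹ : Module.End A Nb) (b ^ k • v) =
      ((↑(powUnit ιb b k)⁻¹ : Module.End A Nb) * (powUnit ιb b k : Module.End A Nb)) v := rfl
  rw [this, Units.inv_mul, Module.End.one_apply]

/-- **The piece map `ψ_k : N → N[1/b]/N`, `n ↦ [n / bᵏ]`.**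
[cite: Cesnavicius2021, proof of Thm. 3.13, (bam-3)] -/
def psi [IsLocalizedModule (Submonoid.powers b) ιb] (k : ℕ) : N →ₗ[A] Nb ⧸ LinearMap.range ιb :=
  (LinearMap.range ιb).mkQ ∘ₗ (↑(powUnit ιb b k)⁻¹ : Module.End A Nb) ∘ₗ ιb

/-- Unfolding of `ψ_k`. [folklore] -/
theorem psi_apply [IsLocalizedModule (Submonoid.powers b) ιb] (k : ℕ) (n : N) :
    psi ιb b k n = Submodule.Quotient.mk ((↑(powUnit ιb b k)⁻¹ : Module.End A Nb) (ιb n)) := rfl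

variable {b} in
/-- **`ker ψ_k = bᵏ N`** (`b` regular on `N`). [folklore] -/
theorem mem_ker_psi_iff [IsLocalizedModule (Submonoid.powers b) ιb] (hbN : IsSMulRegular N b)
    (k : ℕ) (n : N) :
    n ∈ LinearMap.ker (psi ιb b k) ↔ ∃ n' : N, n = b ^ k • n' := by
  rw [LinearMap.mem_ker, psi_apply, Submodule.Quotient.mk_eq_zero]
  constructor
  · rintro ⟨n', hn'⟩
    refine ⟨n', iotab_injective ιb hbN ?_⟩
    rw [LinearMap.map_smul, hn', pow_smul_powUnit_inv]
  · rintro ⟨n', rfl⟩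
    exact ⟨n', by rw [LinearMap.map_smul, powUnit_inv_pow_smul]⟩

/-- `ψ_{k+1} (b n) = ψ_k n`. [folklore] -/
theorem psi_succ_smul [IsLocalizedModule (Submonoid.powers b) ιb] (k : ℕ) (n : N) :
    psi ιb b (k + 1) (b • n) = psi ιb b k n := by
  rw [psi_apply, psi_apply]
  congr 1
  apply ((Module.End.isUnit_iff _).mp (isUnit_smul_pow_iotab ιb b (k + 1))).1
  change b ^ (k + 1) • ((↑(powUnit ιb b (k + 1))⁻¹ : Module.End A Nb) (ιb (b • n))) =
    b ^ (k + 1) • ((↑(powUnit ιb b k)⁻¹ : Module.End A Nb) (ιb n))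
  rw [pow_smul_powUnit_inv, LinearMap.map_smul, pow_succ', mul_smul, pow_smul_powUnit_inv]

/-- **The pieces increase.** [folklore] -/
theorem monotone_range_psi [IsLocalizedModule (Submonoid.powers b) ιb] :
    Monotone fun k => LinearMap.range (psi ιb b k) := by
  refine monotone_nat_of_le_succ fun k => ?_
  rintro _ ⟨n, rfl⟩
  exact ⟨b • n, psi_succ_smul ιb b k n⟩

/-- **The pieces exhaust `N[1/b]/N`.** [folklore] -/
theorem exists_mem_range_psi [IsLocalizedModule (Submonoid.powers b) ιb]
    (w : Nb ⧸ LinearMap.range ιb) :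
    ∃ k, w ∈ LinearMap.range (psi ιb b k) := by
  induction w using Submodule.Quotient.induction_on with | _ v =>
  obtain ⟨k, n, hk⟩ := exists_pow_smul_eq_iotab ιb b v
  refine ⟨k, n, ?_⟩
  rw [psi_apply]
  congr 1
  rw [← hk, powUnit_inv_pow_smul]

end LocB

/-! ## The chart map `κ_b : N[1/b] → Ω` and `φ_b : N[1/b]/N → Ω/sat a` -/

section Chart

variable {Nb : Type u} [AddCommGroup Nb] [Module A Nb] (ιb : N →ₗ[A] Nb)

/-- Powers of `b` act invertibly on `Ω`, in the form needed to extend maps from `N[1/b]`.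
[folklore] -/
theorem isUnit_smul_powers_right (a b : A) [IsLocalizedModule (Submonoid.powers (a * b)) ι]
    (s : Submonoid.powers b) : IsUnit (algebraMap A (Module.End A Ω) s) := by
  obtain ⟨s, k, rfl⟩ := s
  exact isUnit_smul_pow_right ι a b k

/-- **The canonical map `κ_b : N[1/b] → N[1/ab]`.** [folklore] -/
def kappa (a b : A) [IsLocalizedModule (Submonoid.powers (a * b)) ι]
    [IsLocalizedModule (Submonoid.powers b) ιb] : Nb →ₗ[A] Ω :=
  IsLocalizedModule.lift (Submonoid.powers b) ιb ι (isUnit_smul_powers_right ι a b)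

variable (a b : A) [IsLocalizedModule (Submonoid.powers (a * b)) ι]
  [IsLocalizedModule (Submonoid.powers b) ιb]

/-- `κ_b ∘ ι_b = ι`. [folklore] -/
theorem kappa_comp : kappa ι ιb a b ∘ₗ ιb = ι :=
  IsLocalizedModule.lift_comp _ _ _ _

/-- `κ_b (ι_b n) = ι n`. [folklore] -/
@[simp]
theorem kappa_apply (n : N) : kappa ι ιb a b (ιb n) = ι n :=
  LinearMap.congr_fun (kappa_comp ι ιb a b) n

/-- **`range κ_b = sat b`.** [cite: Cesnavicius2021, proof of Thm. 3.13] -/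
theorem range_kappa : LinearMap.range (kappa ι ιb a b) = sat ι b := by
  apply le_antisymm
  · rintro _ ⟨v, rfl⟩
    obtain ⟨k, n, hk⟩ := exists_pow_smul_eq_iotab ιb b v
    exact ⟨k, n, by rw [← LinearMap.map_smul, hk, kappa_apply]⟩
  · rintro ω ⟨k, n, hn⟩
    obtain ⟨u, hu⟩ := isUnit_smul_pow_iotab ιb b k
    refine ⟨(↑u⁻¹ : Module.End A Nb) (ιb n), ?_⟩
    apply smul_cancel_of_isUnit (isUnit_smul_pow_right ι a b k)
    rw [← LinearMap.map_smul, ← hn]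
    have : b ^ k • ((↑u⁻¹ : Module.End A Nb) (ιb n)) = (u * u⁻¹ : Module.End A Nb) (ιb n) := by
      rw [Module.End.mul_apply, hu]; rfl
    rw [this, Units.mul_inv, Module.End.one_apply, kappa_apply]

/-- **`κ_b` is injective when `a` is `N`-regular.** [folklore] -/
theorem kappa_injective (ha : IsSMulRegular N a) : Function.Injective (kappa ι ιb a b) := by
  rw [← LinearMap.ker_eq_bot, LinearMap.ker_eq_bot']
  intro v hv
  obtain ⟨k, n, hk⟩ := exists_pow_smul_eq_iotab ιb b v
  have h1 : ι n = 0 := by rw [← kappa_apply ι ιb a b, ← hk, LinearMap.map_smul, hv, smul_zero]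
  obtain ⟨⟨s, j, rfl⟩, hs⟩ := (IsLocalizedModule.eq_zero_iff (Submonoid.powers (a * b)) ι).mp h1
  rw [Submonoid.smul_def] at hs
  have h2 : b ^ j • n = 0 := (ha.pow j) (by
    simpa only [smul_zero, mul_pow, mul_smul] using hs)
  have h3 : b ^ (j + k) • v = 0 := by
    rw [pow_add, mul_smul, hk, ← LinearMap.map_smul, h2, map_zero]
  obtain ⟨u, hu⟩ := isUnit_smul_pow_iotab ιb b (j + k)
  have h4 : (u : Module.End A Nb) v = 0 := by rw [hu]; exact h3
  have h5 : ((↑u⁻¹ : Module.End A Nb) * (u : Module.End A Nb)) v = 0 := by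
    rw [Module.End.mul_apply, h4, map_zero]
  rwa [Units.inv_mul, Module.End.one_apply] at h5

/-- `κ_b v ∈ ι(N)` forces `v ∈ ι_b(N)` (`a` regular on `N`). [folklore] -/
theorem mem_range_of_kappa_mem_range (ha : IsSMulRegular N a) {v : Nb}
    (hv : kappa ι ιb a b v ∈ LinearMap.range ι) : v ∈ LinearMap.range ιb := by
  obtain ⟨n, hn⟩ := hv
  exact ⟨n, kappa_injective ι ιb a b ha (by rw [kappa_apply, hn])⟩

/-- `ι_b(N)` maps into `sat a` under `κ_b`. [folklore] -/
theorem range_le_comap_kappa_sat : LinearMap.range ιb ≤ (sat ι a).comap (kappa ι ιb a b) := by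
  rintro _ ⟨n, rfl⟩
  rw [Submodule.mem_comap, kappa_apply]
  exact range_le_sat ι a ⟨n, rfl⟩

/-- **The chart map `φ_b : N[1/b]/N → Ω/sat a`** induced by `κ_b`.
[cite: Cesnavicius2021, proof of Thm. 3.13] -/
def phi : (Nb ⧸ LinearMap.range ιb) →ₗ[A] Ω ⧸ sat ι a :=
  Submodule.mapQ _ _ (kappa ι ιb a b) (range_le_comap_kappa_sat ι ιb a b)

/-- `φ_b [v] = [κ_b v]`. [folklore] -/
@[simp]
theorem phi_mk (v : Nb) :
    phi ι ιb a b (Submodule.Quotient.mk v) = Submodule.Quotient.mk (kappa ι ιb a b v) :=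
  rfl

/-- Membership in `ker φ_b`. [folklore] -/
theorem mk_mem_ker_phi_iff (v : Nb) :
    Submodule.Quotient.mk v ∈ LinearMap.ker (phi ι ιb a b) ↔ kappa ι ιb a b v ∈ sat ι a := by
  rw [LinearMap.mem_ker, phi_mk, Submodule.Quotient.mk_eq_zero]

/-- **`ker φ_b` is the `a`-power torsion of `N[1/b]/N`** (`a` regular on `N`): `[v] ∈ ker φ_b` iff
`aⁿ [v] = 0` for some `n`. [cite: Cesnavicius2021, proof of Thm. 3.13, (bam-2)] -/
theorem mem_ker_phi_iff_exists_pow_smul_eq_zero (ha : IsSMulRegular N a)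
    (w : Nb ⧸ LinearMap.range ιb) :
    w ∈ LinearMap.ker (phi ι ιb a b) ↔ ∃ n : ℕ, a ^ n • w = 0 := by
  induction w using Submodule.Quotient.induction_on with | _ v =>
  rw [mk_mem_ker_phi_iff]
  constructor
  · rintro ⟨n, hn⟩
    refine ⟨n, ?_⟩
    rw [← Submodule.Quotient.mk_smul, Submodule.Quotient.mk_eq_zero]
    exact mem_range_of_kappa_mem_range ι ιb a b ha (by rwa [LinearMap.map_smul])
  · rintro ⟨n, hn⟩
    rw [← Submodule.Quotient.mk_smul, Submodule.Quotient.mk_eq_zero] at hn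
    obtain ⟨m, hm⟩ := hn
    exact ⟨n, m, by rw [← LinearMap.map_smul, ← hm, kappa_apply]⟩

/-- **`a` and `b` kill `ker φ_b`** as soon as they multiply `sat a ⊓ sat b` into `ι(N)` — the
form in which Česnavičius's Claim 3.13.2 ("both `r_i` and `r_s` kill `H¹_{(r_i,r_s)}(M')`") is
consumed. [cite: Cesnavicius2021, proof of Thm. 3.13, Claim 3.13.2] -/
theorem smul_eq_zero_of_mem_ker_phi (ha : IsSMulRegular N a)
    (hkill : ∀ ω ∈ sat ι a ⊓ sat ι b, a • ω ∈ LinearMap.range ι ∧ b • ω ∈ LinearMap.range ι)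
    {w : Nb ⧸ LinearMap.range ιb} (hw : w ∈ LinearMap.ker (phi ι ιb a b)) :
    a • w = 0 ∧ b • w = 0 := by
  induction w using Submodule.Quotient.induction_on with | _ v =>
  rw [mk_mem_ker_phi_iff] at hw
  have hb' : kappa ι ιb a b v ∈ sat ι b := by rw [← range_kappa ι ιb a b]; exact ⟨v, rfl⟩
  obtain ⟨h1, h2⟩ := hkill _ ⟨hw, hb'⟩
  constructor
  · rw [← Submodule.Quotient.mk_smul, Submodule.Quotient.mk_eq_zero]
    exact mem_range_of_kappa_mem_range ι ιb a b ha (by rwa [LinearMap.map_smul])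
  · rw [← Submodule.Quotient.mk_smul, Submodule.Quotient.mk_eq_zero]
    exact mem_range_of_kappa_mem_range ι ιb a b ha (by rwa [LinearMap.map_smul])

end Chart

/-! ## The symmetric models `E1 ≅ H¹_{(a,b)}(N)`, `E2 ≅ H²_{(a,b)}(N)` -/

/-- **The symmetric model of `H¹_{(a,b)}(N)`**: `(sat a ⊓ sat b) mod ι(N)`, a submodule of
`Ω/ι(N)`. [cite: Cesnavicius2021, proof of Thm. 3.13] -/
abbrev E1 (a b : A) : Type u := ↥((sat ι a ⊓ sat ι b).map (LinearMap.range ι).mkQ)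

/-- **The symmetric model of `H²_{(a,b)}(N)`**: `Ω/(sat a + sat b)`.
[cite: Cesnavicius2021, proof of Thm. 3.13] -/
abbrev E2 (a b : A) : Type u := Ω ⧸ (sat ι a ⊔ sat ι b)

/-- `E1` is symmetric in `a, b`. [folklore] -/
def E1Comm (a b : A) : E1 ι a b ≃ₗ[A] E1 ι b a :=
  LinearEquiv.ofEq _ _ (by rw [inf_comm])

/-- `E2` is symmetric in `a, b`. [folklore] -/
def E2Comm (a b : A) : E2 ι a b ≃ₗ[A] E2 ι b a :=
  Submodule.quotEquivOfEq _ _ (sup_comm _ _)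

section KerCoker

variable {Nb : Type u} [AddCommGroup Nb] [Module A Nb] (ιb : N →ₗ[A] Nb)
variable (a b : A) [IsLocalizedModule (Submonoid.powers (a * b)) ι]
  [IsLocalizedModule (Submonoid.powers b) ιb]

/-- `ι_b(N)` maps into `ι(N)` under `κ_b`. [folklore] -/
theorem range_le_comap_kappa_range :
    LinearMap.range ιb ≤ (LinearMap.range ι).comap (kappa ι ιb a b) := by
  rintro _ ⟨n, rfl⟩
  rw [Submodule.mem_comap, kappa_apply]
  exact ⟨n, rfl⟩

/-- The map `N[1/b]/N → Ω/ι(N)` induced by `κ_b`. [folklore] -/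
def kerToQuot : (Nb ⧸ LinearMap.range ιb) →ₗ[A] Ω ⧸ LinearMap.range ι :=
  Submodule.mapQ _ _ (kappa ι ιb a b) (range_le_comap_kappa_range ι ιb a b)

/-- `kerToQuot [v] = [κ_b v]`. [folklore] -/
@[simp]
theorem kerToQuot_mk (v : Nb) :
    kerToQuot ι ιb a b (Submodule.Quotient.mk v) = Submodule.Quotient.mk (kappa ι ιb a b v) :=
  rfl

/-- `kerToQuot` is injective (`a` regular on `N`). [folklore] -/
theorem kerToQuot_injective (ha : IsSMulRegular N a) : Function.Injective (kerToQuot ι ιb a b) := by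
  rw [← LinearMap.ker_eq_bot, LinearMap.ker_eq_bot']
  intro w hw
  induction w using Submodule.Quotient.induction_on with | _ v =>
  rw [kerToQuot_mk, Submodule.Quotient.mk_eq_zero] at hw
  rw [Submodule.Quotient.mk_eq_zero]
  exact mem_range_of_kappa_mem_range ι ιb a b ha hw

/-- The image of `ker φ_b` in `Ω/ι(N)` is `(sat a ⊓ sat b) mod ι(N)`. [folklore] -/
theorem map_kerToQuot_ker_phi :
    (LinearMap.ker (phi ι ιb a b)).map (kerToQuot ι ιb a b) =
      (sat ι a ⊓ sat ι b).map (LinearMap.range ι).mkQ := by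
  apply le_antisymm
  · rintro _ ⟨w, hw, rfl⟩
    induction w using Submodule.Quotient.induction_on with | _ v =>
    rw [SetLike.mem_coe, mk_mem_ker_phi_iff] at hw
    have hb' : kappa ι ιb a b v ∈ sat ι b := by rw [← range_kappa ι ιb a b]; exact ⟨v, rfl⟩
    exact ⟨kappa ι ιb a b v, ⟨hw, hb'⟩, rfl⟩
  · rintro _ ⟨ω, ⟨hωa, hωb⟩, rfl⟩
    rw [← range_kappa ι ιb a b] at hωb
    obtain ⟨v, rfl⟩ := hωb
    exact ⟨Submodule.Quotient.mk v, (mk_mem_ker_phi_iff ι ιb a b v).mpr hωa, rfl⟩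

/-- **`ker φ_b ≅ (sat a ⊓ sat b)/ι(N) = E1`** (`a` regular on `N`).
[cite: Cesnavicius2021, proof of Thm. 3.13, (bam-2)] -/
def kerPhiEquiv (ha : IsSMulRegular N a) : LinearMap.ker (phi ι ιb a b) ≃ₗ[A] E1 ι a b :=
  (LinearEquiv.ofInjective (kerToQuot ι ιb a b ∘ₗ (LinearMap.ker (phi ι ιb a b)).subtype)
    ((kerToQuot_injective ι ιb a b ha).comp (Submodule.injective_subtype _))).trans
    (LinearEquiv.ofEq _ _ (by
      rw [LinearMap.range_comp, Submodule.range_subtype, map_kerToQuot_ker_phi]))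

/-- `range φ_b = (sat b) mod (sat a)`. [folklore] -/
theorem range_phi : LinearMap.range (phi ι ιb a b) = (sat ι b).map (sat ι a).mkQ := by
  apply le_antisymm
  · rintro _ ⟨w, rfl⟩
    induction w using Submodule.Quotient.induction_on with | _ v =>
    refine ⟨kappa ι ιb a b v, ?_, rfl⟩
    rw [← range_kappa ι ιb a b]
    exact ⟨v, rfl⟩
  · rintro _ ⟨ω, hω, rfl⟩
    rw [← range_kappa ι ιb a b] at hω
    obtain ⟨v, rfl⟩ := hω
    exact ⟨Submodule.Quotient.mk v, rfl⟩

omit [IsLocalizedModule (Submonoid.powers (a * b)) ι] in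
/-- `(sat a ⊔ sat b) mod (sat a) = (sat b) mod (sat a)`. [folklore] -/
theorem map_mkQ_sup_sat : (sat ι a ⊔ sat ι b).map (sat ι a).mkQ = (sat ι b).map (sat ι a).mkQ := by
  rw [Submodule.map_sup, Submodule.mkQ_map_self, bot_sup_eq]

/-- **`(Ω/sat a)/range φ_b ≅ Ω/(sat a + sat b) = E2`.**
[cite: Cesnavicius2021, proof of Thm. 3.13, (bam-3)] -/
def cokerPhiEquiv : ((Ω ⧸ sat ι a) ⧸ LinearMap.range (phi ι ιb a b)) ≃ₗ[A] E2 ι a b :=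
  (Submodule.quotEquivOfEq _ _ (by rw [range_phi, map_mkQ_sup_sat])).trans
    (Submodule.quotientQuotientEquivQuotient (sat ι a) (sat ι a ⊔ sat ι b) le_sup_left)

/-! ## The depth derivation (two-row exact sequence, vanishing form) -/

variable {s : ℕ} {y : Fin s → A}

/-- **Row `j' = 1`**: `Hʲ(ker φ_b) = 0` for `j < m` if `Hʲ(N) = 0` and `Hʲ(range φ_b) = 0` for
`j < m + 1`. [cite: Cesnavicius2021, proof of Thm. 3.13, Claim 3.13.1] -/
theorem cechVanishBelow_ker_phi (hb : b ∈ (Ideal.span (Set.range y)).radical)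
    (hbN : IsSMulRegular N b) {m : ℕ} (hN : CechVanishBelow y N (m + 1))
    (hD : CechVanishBelow y (LinearMap.range (phi ι ιb a b)) (m + 1)) :
    CechVanishBelow y (LinearMap.ker (phi ι ιb a b)) m := by
  cases m with
  | zero => exact CechVanishBelow.zero
  | succ m =>
    exact CechVanishBelow.left (φ := (LinearMap.ker (phi ι ιb a b)).subtype)
      (ψ := (phi ι ιb a b).rangeRestrict) (Submodule.injective_subtype _)
      (LinearMap.surjective_rangeRestrict _)
      ((LinearMap.exact_iff).mpr (by rw [LinearMap.ker_rangeRestrict, Submodule.range_subtype]))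
      (hD.mono (by omega)) (cechVanishBelow_quotient_range ιb hb hbN hN)

/-- **Row `j' = 2`**: `Hʲ((Ω/sat a)/range φ_b) = 0` for `j < m` if `Hʲ(range φ_b) = 0` for
`j < m + 1` (`a ∈ √(y)` acts bijectively on `Ω/sat a`).
[cite: Cesnavicius2021, proof of Thm. 3.13, Claim 3.13.1] -/
theorem cechVanishBelow_coker_phi (ha : a ∈ (Ideal.span (Set.range y)).radical) {m : ℕ}
    (hD : CechVanishBelow y (LinearMap.range (phi ι ιb a b)) (m + 1)) :
    CechVanishBelow y ((Ω ⧸ sat ι a) ⧸ LinearMap.range (phi ι ιb a b)) m :=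
  CechVanishBelow.right_of_forall (φ := (LinearMap.range (phi ι ιb a b)).subtype)
    (ψ := (LinearMap.range (phi ι ιb a b)).mkQ) (Submodule.injective_subtype _)
    (Submodule.mkQ_surjective _) (LinearMap.exact_subtype_mkQ _)
    (CechVanishBelow.of_smul_bijective ha (smul_bijective_quotient_sat ι a b)) hD

/-- **The two rows, symmetric models**: `Hʲ(E1) = 0` and `Hʲ(E2) = 0` for `j < m`.
[cite: Cesnavicius2021, proof of Thm. 3.13, Claim 3.13.1] -/
theorem cechVanishBelow_E1_E2 (ha : a ∈ (Ideal.span (Set.range y)).radical)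
    (hb : b ∈ (Ideal.span (Set.range y)).radical) (haN : IsSMulRegular N a)
    (hbN : IsSMulRegular N b) {m : ℕ} (hN : CechVanishBelow y N (m + 1))
    (hD : CechVanishBelow y (LinearMap.range (phi ι ιb a b)) (m + 1)) :
    CechVanishBelow y (E1 ι a b) m ∧ CechVanishBelow y (E2 ι a b) m :=
  ⟨(cechVanishBelow_ker_phi ι ιb a b hb hbN hN hD).of_equiv (kerPhiEquiv ι ιb a b haN),
    (cechVanishBelow_coker_phi ι ιb a b ha hD).of_equiv (cokerPhiEquiv ι ιb a b)⟩

end KerCoker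

section PiecesPair

variable {Nb : Type u} [AddCommGroup Nb] [Module A Nb] (ιb : N →ₗ[A] Nb) (a b : A)
  [IsLocalizedModule (Submonoid.powers (a * b)) ι] [IsLocalizedModule (Submonoid.powers b) ιb]

/-- **`ker (φ_b ∘ ψ_k)` is the `a`-saturation of `bᵏN`**: `n ↦ 0` iff `aʲ n ∈ bᵏ N` for some `j`
(`a, b` regular on `N`). [cite: Cesnavicius2021, proof of Thm. 3.13, (bam-4)] -/
theorem mem_ker_phi_comp_psi_iff (ha : IsSMulRegular N a) (hbN : IsSMulRegular N b) (k : ℕ)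
    (n : N) : n ∈ LinearMap.ker (phi ι ιb a b ∘ₗ psi ιb b k) ↔
      ∃ (j : ℕ) (n' : N), a ^ j • n = b ^ k • n' := by
  rw [LinearMap.mem_ker, LinearMap.comp_apply, ← LinearMap.mem_ker,
    mem_ker_phi_iff_exists_pow_smul_eq_zero ι ιb a b ha]
  constructor
  · rintro ⟨j, hj⟩
    rw [← LinearMap.map_smul, ← LinearMap.mem_ker, mem_ker_psi_iff ιb hbN] at hj
    obtain ⟨n', hn'⟩ := hj
    exact ⟨j, n', hn'⟩
  · rintro ⟨j, n', hj⟩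
    refine ⟨j, ?_⟩
    rw [← LinearMap.map_smul, ← LinearMap.mem_ker, mem_ker_psi_iff ιb hbN]
    exact ⟨n', hj⟩

/-- **`range φ_b` is the increasing union of the images of the pieces**, hence its local
cohomology vanishing follows from that of the modules `N / ker(φ_b ∘ ψ_k)`.
[cite: Cesnavicius2021, proof of Thm. 3.13, (bam-bam)] -/
theorem cechVanishBelow_range_phi_of_pieces {s : ℕ} {y : Fin s → A} {m : ℕ}
    (h : ∀ k, CechVanishBelow y (N ⧸ LinearMap.ker (phi ι ιb a b ∘ₗ psi ιb b k)) m) :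
    CechVanishBelow y (LinearMap.range (phi ι ιb a b)) m := by
  -- the pieces `D_k = (φ ∘ ψ_k)(N)`, as submodules of `range φ`
  have hmem : ∀ k (w : N ⧸ LinearMap.ker (phi ι ιb a b ∘ₗ psi ιb b k)),
      (LinearMap.ker (phi ι ιb a b ∘ₗ psi ιb b k)).liftQ (phi ι ιb a b ∘ₗ psi ιb b k) le_rfl w ∈
        LinearMap.range (phi ι ιb a b) := by
    intro k w
    induction w using Submodule.Quotient.induction_on with | _ n =>
    exact ⟨psi ιb b k n, rfl⟩
  let g : ∀ k, (N ⧸ LinearMap.ker (phi ι ιb a b ∘ₗ psi ιb b k)) →ₗ[A]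
      LinearMap.range (phi ι ιb a b) := fun k =>
    LinearMap.codRestrict _ ((LinearMap.ker (phi ι ιb a b ∘ₗ psi ιb b k)).liftQ
      (phi ι ιb a b ∘ₗ psi ιb b k) le_rfl) (hmem k)
  have hg : ∀ k (n : N), (g k (Submodule.Quotient.mk n) : Ω ⧸ sat ι a) =
      phi ι ιb a b (psi ιb b k n) := fun k n => rfl
  refine CechVanishBelow.of_iUnion_range g (fun k => ?_) ?_ ?_ h
  · -- injective
    rw [← LinearMap.ker_eq_bot, LinearMap.ker_eq_bot']
    intro w hw
    induction w using Submodule.Quotient.induction_on with | _ n =>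
    rw [Submodule.Quotient.mk_eq_zero, LinearMap.mem_ker, LinearMap.comp_apply]
    have := congrArg Subtype.val hw
    rwa [hg] at this
  · -- monotone
    refine monotone_nat_of_le_succ fun k => ?_
    rintro _ ⟨w, rfl⟩
    induction w using Submodule.Quotient.induction_on with | _ n =>
    refine ⟨Submodule.Quotient.mk (b • n), Subtype.ext ?_⟩
    rw [hg, hg, psi_succ_smul]
  · -- exhaustive
    rintro ⟨_, w, rfl⟩
    obtain ⟨k, n, hn⟩ := exists_mem_range_psi ιb b w
    exact ⟨k, Submodule.Quotient.mk n, Subtype.ext (by rw [hg, hn])⟩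

end PiecesPair

end Literature.RingTheory.LocalCohomology

end
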